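import Summits.QuantumFields.YangMills.Theorems.BalabanUVNodesN15BackgroundV1CoarseTriple
import Summits.QuantumFields.YangMills.Theorems.BalabanUVNodesN15BackgroundVWordsNode
import HarnessLib

/-!
# Route «BalabanUVNodes» (K4 «SpineRates»), node N15 = NE2, BACKGROUND LAYER — THE (3.60)-SHAPED FULL PERTURBATION `V′ = V′₁ − W` WITH THE COARSE `V′₁` AT THE
# MEAN FIELD's OWN TRIPLE: letters, the four (3.42) entries, `EtaRateIneq342` per index, the kernel family over the gauge carrier (F2∕F3 re-keyed on
# `v1C_letters_of_gauge`; the node theorem is the sequel `…BackgroundVWordsCoarseNode`)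

Cell `pub-ymgap`, seat `pub-ymgap-dag-n15-c` (generation g4; R134 ACCELERATION SEAT, strategy s1; HUMAN RULING D-0062; chair R424 venue; `bears_on: R4∕N15`).
Filed `--supports stmt-QuantumFields-19912 --as helper` (K3‴ `SpineGivenEndpointR13`; KEY TABLE WORDS-133; helper, count-neutral).  Imports BY NAME, nothing in the
tree modified: this seat's `…N15BackgroundV1CoarseTriple` (**`v1C_letters_of_gauge`**), F2 `…N15BackgroundVWordsByName` (`vWPert`, `vWR`, `gVWc35`, `vWR_nonneg_le`,
`le_gVWc35`, `hasMaj_sub_word`, `hasMaj_idef_sub_word`; texts of `vW_letters_of_reg335` ∕ `vWEntries` ∕ `hasMaj_vWEntries` ∕ `etaRateIneq342_vWEntries` are the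
templates), g3 (`v1GaugeBg`, `v1GaugeInstance`), g0 (`hasMaj_entries_of_letters`, `etaRateIneq342_of_hasMaj`, `entryMajorant_le_etaRateShape`, `opFamily`).

CONTENTS (namespace `…N15.BackgroundLayer`).  §1 **`vWC_letters_of_gauge`**.  §2 `vWEntriesC` (def: the four entries at a fine triple, an EXPLICIT coarse triple and a
word pair), `vWGOpsC4` ∕ `vWGCFamily4` (defs: ops and kernel family over g3's paired gauge instance, coarse triple `(Ā, Ā∘s⁻¹, ∇*Ā)` of `Ā = gavgM π A′`),
**`hasMaj_vWEntriesC`**, **`etaRateIneq342_vWEntriesC`** (any carrier∕family evaluating to the entries).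

HONEST FRAMING ∕ LIMITS.  Transport = fibrewise mean (linearised (C3)); `U ≡ 1` shapes; crude constants (`2c′`); generic carriers.  NE2⁺ NOT PRINTED; count-neutral
(typed 28∕28 · discharged unchanged); NOT a discharge of N15; one finite lattice at fixed ε — NOT infinite volume, NOT OS on ℝ⁴, NOT a mass gap, NOT Clay.
-/

noncomputable section

open scoped BigOperators

namespace Summit.QuantumFields.YangMills.BalabanUVNodes.N15.BackgroundLayer

open Literature.MathematicalPhysics.QuantumFieldTheory.Balaban1983to89
open Literature.MathematicalPhysics.QuantumFieldTheory.Balaban1983to89.B11SectG (BlockNorm HasMaj RowSum)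
open Literature.MathematicalPhysics.QuantumFieldTheory.Balaban1983to89.T4EtaRate (PairedInstance EtaRateIneq342 rateFactor)
open Literature.MathematicalPhysics.QuantumFieldTheory.Balaban1983to89.T4EtaRateDefect (idef rateWeight)
open Literature.MathematicalPhysics.QuantumFieldTheory.Balaban1983to89.T4EtaRateCoeffDefect (pull diagK diagK_mono)
open Literature.MathematicalPhysics.QuantumFieldTheory.Balaban1983to89.B6RandomWalk (Triangle254)
open Summit.QuantumFields.YangMills.BalabanUVNodes.N15.OperatorReadout (opGeo opFamily opGeo_len etaRateIneq342_of_hasMaj)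
open Summit.QuantumFields.YangMills.BalabanUVNodes.N15.MatrixSpecies (liftMap liftBlk basisConst basisConst_nonneg)

/-! ## §1 The letters of the full perturbation with the pairing-consistent coarse side -/

section Letters

variable {X X' J ι : Type} [Fintype X] [Fintype X'] [Fintype J] [Fintype ι] [DecidableEq X] [DecidableEq ι] {𝔄 : Type} [NormedRing 𝔄]
  [NormedAlgebra ℝ 𝔄] [CompleteSpace 𝔄] (e : 𝔄 ≃L[ℝ] (ι → ℝ)) {g : B6.Geometry} (blk : X → g.Site) (π : X' → X)

/-- **THE THREE PERTURBATION LETTERS OF THE FULL `V′ = V′₁ − W` WITH THE COARSE `V′₁` AT THE MEAN FIELD's OWN TRIPLE.**  F2's `vW_letters_of_reg335` with its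
`V′₁` input replaced by `v1C_letters_of_gauge`: one gauge field `A′` with C² letters at `c`, commuting fine shifts, `C_π`-step-connected fibres, the block-translation
law `π∘(s′_μ)^N = s_μ∘π`, `η = Nη′`, `(2+|J|)c ≤ c′`, `(1+|J|)C_π·cMα₀η′ ≤ c′Mα₀θ`, guard `2(2c′)a₀ ≤ 1`; species letters at `c_W·(2c′)Mα₀`.  Outputs: `0 ≤ vWR(2c′) ≤
gVWc35(2c′)·a₀`, majorants `diagK vWR(2c′)` of the coarse `vWPert` (COEFFICIENTS AT `(Ā, Ā∘s⁻¹, ∇*Ā)`, `Ā = gavgM π A′`) and of the fine one, η-defect `diagK (vWR(2c′)·θ)`.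
[cite: Balaban1985BackgroundPropagators, (3.35) p.396, (3.52) p.400, (3.59)–(3.61) p.402 (shapes)] -/
theorem vWC_letters_of_gauge {s : J → X ≃ X} {s' : J → X' ≃ X'} {N : ℕ}
    {η η' θ c c' a₀ M α₀ Cπ cW : ℝ}
    (hcomm : ∀ μ κ x, (s' μ).symm (s' κ x) = s' κ ((s' μ).symm x)) (hCπ : 0 ≤ Cπ)
    (hconn : ∀ (f : X' → 𝔄) (b : ℝ), (∀ κ x, ‖f (s' κ x) - f x‖ ≤ b) → ∀ x₁ x₂, π x₁ = π x₂ → ‖f x₁ - f x₂‖ ≤ Cπ * b)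
    (hblk : ∀ μ x', π ((s' μ ^ N) x') = s μ (π x')) (hη' : 0 < η') (hη'η : η' ≤ η) (hη1 : η ≤ 1) (hηθ : η ≤ θ) (hN : η = N * η')
    (hc : 0 ≤ c) (hc'0 : 0 < c') (hcc' : (2 + Fintype.card J) * c ≤ c') (hθ' : (1 + Fintype.card J) * Cπ * (c * M * α₀) * η' ≤ c' * M * α₀ * θ)
    (hM : 1 ≤ M) (hα₀ : 0 < α₀) (hMα : M * α₀ ≤ a₀) (ha₀1 : 2 * (2 * c' * a₀) ≤ 1) (hcW : 0 ≤ cW)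
    {A' : J → X' → 𝔄} (hreg : (v1GaugeBg 𝔄 J s' η' M).Reg335 c α₀ A')
    {W : (X × ι → ℝ) →ₗ[ℝ] (X × ι → ℝ)} {W' : (X' × ι → ℝ) →ₗ[ℝ] (X' × ι → ℝ)}
    (hW : HasMaj (BlockNorm.ofBlocks g (liftBlk blk ι)) (BlockNorm.ofBlocks g (liftBlk blk ι)) W (diagK fun _ => cW * (2 * c' * M * α₀)))
    (hW' : HasMaj (BlockNorm.ofBlocks g (liftBlk (blk ∘ π) ι)) (BlockNorm.ofBlocks g (liftBlk (blk ∘ π) ι)) W' (diagK fun _ => cW * (2 * c' * M * α₀)))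
    (hDW : HasMaj (BlockNorm.ofBlocks g (liftBlk blk ι)) (BlockNorm.ofBlocks g (liftBlk (blk ∘ π) ι))
      (idef (pull (liftMap π ι)) (pull (liftMap π ι)) W' W) (diagK fun _ => cW * (2 * c' * M * α₀) * θ)) :
    0 ≤ vWR J (basisConst e) (2 * c') M α₀ cW ∧ vWR J (basisConst e) (2 * c') M α₀ cW ≤ gVWc35 J (basisConst e) (2 * c') cW * a₀ ∧
      HasMaj (BlockNorm.ofBlocks g (blkPair (liftBlk blk ι))) (BlockNorm.ofBlocks g (liftBlk blk ι))
        (vWPert (v1coefC e η (v1fieldsOfGauge 𝔄 J s η (gavgM 𝔄 J π A'))) (v1coefA e η (v1fieldsOfGauge 𝔄 J s η (gavgM 𝔄 J π A'))) W) (diagK fun _ => vWR J (basisConst e) (2 * c') M α₀ cW) ∧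
      HasMaj (BlockNorm.ofBlocks g (blkPair (liftBlk (blk ∘ π) ι))) (BlockNorm.ofBlocks g (liftBlk (blk ∘ π) ι))
        (vWPert (v1coefC e η' (v1fieldsOfGauge 𝔄 J s' η' A')) (v1coefA e η' (v1fieldsOfGauge 𝔄 J s' η' A')) W') (diagK fun _ => vWR J (basisConst e) (2 * c') M α₀ cW) ∧
      HasMaj (BlockNorm.ofBlocks g (blkPair (liftBlk blk ι))) (BlockNorm.ofBlocks g (liftBlk (blk ∘ π) ι))
        (idef (pull (liftPair (liftMap π ι))) (pull (liftMap π ι)) (vWPert (v1coefC e η' (v1fieldsOfGauge 𝔄 J s' η' A')) (v1coefA e η' (v1fieldsOfGauge 𝔄 J s' η' A')) W')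
          (vWPert (v1coefC e η (v1fieldsOfGauge 𝔄 J s η (gavgM 𝔄 J π A'))) (v1coefA e η (v1fieldsOfGauge 𝔄 J s η (gavgM 𝔄 J π A'))) W))
        (diagK fun _ => vWR J (basisConst e) (2 * c') M α₀ cW * θ) := by
  obtain ⟨_, _, hV, hV', hDV⟩ := v1C_letters_of_gauge e (g := g) blk π hcomm hCπ hconn hblk hη' hη'η hη1 hηθ hN hc hcc' hθ' hM hα₀ hMα ha₀1 hreg
  obtain ⟨hR0, hRa⟩ := vWR_nonneg_le (J := J) (basisConst_nonneg e) (by positivity : 0 < 2 * c') hcW hM hα₀ hMα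
  have hM0 : 0 ≤ M := zero_le_one.trans hM
  have hr0 : 0 ≤ cW * (2 * c' * M * α₀) := by positivity
  have hθ0 : 0 ≤ θ := (hη'.le.trans hη'η).trans hηθ
  have hRθ : 16 * Real.exp 1 * (1 + Fintype.card J) * basisConst e * (2 * c' * M * α₀) * θ * (1 + Fintype.card (J ⊕ J)) =
      16 * Real.exp 1 * (1 + Fintype.card J) * basisConst e * (2 * c' * M * α₀) * (1 + Fintype.card (J ⊕ J)) * θ := by ring
  rw [hRθ] at hDV
  refine ⟨hR0, hRa, hasMaj_sub_word (liftBlk blk ι) hr0 hV hW, hasMaj_sub_word (liftBlk (blk ∘ π) ι) hr0 hV' hW', ?_⟩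
  refine (hasMaj_idef_sub_word (liftBlk blk ι) (liftMap π ι) (mul_nonneg hr0 hθ0) hDV hDW).mono fun y y' => diagK_mono (fun _ => le_of_eq ?_) y y'
  unfold vWR; ring


end Letters

/-! ## §2 The four entries, the ops and family over the gauge carrier, `EtaRateIneq342` -/

section Entries

variable {X X' J ι : Type} [Fintype X] [Fintype X'] [Fintype J] [Fintype ι] [DecidableEq X] [DecidableEq X'] [DecidableEq J] [DecidableEq ι]
  {𝔄 : Type} [NormedRing 𝔄] [NormedAlgebra ℝ 𝔄] [CompleteSpace 𝔄] (e : 𝔄 ≃L[ℝ] (ι → ℝ)) {g : B6.Geometry} (blk : X → g.Site) (π : X' → X)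


/-- THE FOUR η-DIFFERENCE ENTRY OPERATORS at a fine triple `T` and an EXPLICIT coarse triple `T_c` (F2's `vWEntries` had `T_c = v1avg T` hard-wired), dressed by a
word pair `W` (coarse), `W′` (fine). [cite: Balaban1985BackgroundPropagators, (3.42) p.397 (the four entries: shape); (3.52) p.400, (3.60) p.402 (shapes)] -/
def vWEntriesC (η η' : ℝ) (ν : J ⊕ J) (G S D₃ : (X × ι → ℝ) →ₗ[ℝ] (X × ι → ℝ)) (D SD : J ⊕ J → (X × ι → ℝ) →ₗ[ℝ] (X × ι → ℝ))
    (G' S' D₃' : (X' × ι → ℝ) →ₗ[ℝ] (X' × ι → ℝ)) (D' SD' : J ⊕ J → (X' × ι → ℝ) →ₗ[ℝ] (X' × ι → ℝ))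
    (T : (J → X' → 𝔄) × (J → X' → 𝔄) × (X' → 𝔄)) (Tc : (J → X → 𝔄) × (J → X → 𝔄) × (X → 𝔄))
    (W : (X × ι → ℝ) →ₗ[ℝ] (X × ι → ℝ)) (W' : (X' × ι → ℝ) →ₗ[ℝ] (X' × ι → ℝ)) :
    Fin 4 → ((X × ι → ℝ) →ₗ[ℝ] (X' × ι → ℝ)) :=
  ![idef (pull (liftMap π ι)) (pull (liftMap π ι)) (projO none ∘ₗ bgPropV (stack G' D') (vWPert (v1coefC e η' T) (v1coefA e η' T) W'))
      (projO none ∘ₗ bgPropV (stack G D) (vWPert (v1coefC e η Tc) (v1coefA e η Tc) W)),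
    idef (pull (liftMap π ι)) (pull (liftMap π ι)) (projO (some ν) ∘ₗ bgPropV (stack G' D') (vWPert (v1coefC e η' T) (v1coefA e η' T) W'))
      (projO (some ν) ∘ₗ bgPropV (stack G D) (vWPert (v1coefC e η Tc) (v1coefA e η Tc) W)),
    idef (pull (liftMap π ι)) (pull (liftMap π ι))
      (projO none ∘ₗ bgSourceV (stack G' D') (stack S' SD') (vWPert (v1coefC e η' T) (v1coefA e η' T) W'))
      (projO none ∘ₗ bgSourceV (stack G D) (stack S SD) (vWPert (v1coefC e η Tc) (v1coefA e η Tc) W)),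
    idef (pull (liftMap π ι)) (pull (liftMap π ι)) (bgDerivedV (stack G' D') D₃' (vWPert (v1coefC e η' T) (v1coefA e η' T) W'))
      (bgDerivedV (stack G D) D₃ (vWPert (v1coefC e η Tc) (v1coefA e η Tc) W))]

/-- THE KERNEL-FAMILY OPS over the GAUGE carrier with the pairing-consistent coarse side: fine triple `(A′, A′∘s′⁻¹, ∇′*A′)`, coarse triple `(Ā, Ā∘s⁻¹, ∇*Ā)` of
`Ā = gavgM π A′`, words `Wc A′`, `Wf A′`. [cite: Balaban1985BackgroundPropagators, (3.42) p.397, (3.52) p.400, (3.60) p.402 (shapes)] -/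
def vWGOpsC4 (Wc : (J → X' → 𝔄) → ((X × ι → ℝ) →ₗ[ℝ] (X × ι → ℝ))) (Wf : (J → X' → 𝔄) → ((X' × ι → ℝ) →ₗ[ℝ] (X' × ι → ℝ)))
    (s : J → X ≃ X) (s' : J → X' ≃ X') (η η' : ℝ) (ν : J ⊕ J) (G S D₃ : (X × ι → ℝ) →ₗ[ℝ] (X × ι → ℝ))
    (D SD : J ⊕ J → (X × ι → ℝ) →ₗ[ℝ] (X × ι → ℝ)) (G' S' D₃' : (X' × ι → ℝ) →ₗ[ℝ] (X' × ι → ℝ)) (D' SD' : J ⊕ J → (X' × ι → ℝ) →ₗ[ℝ] (X' × ι → ℝ)) :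
    Fin 4 → (J → X' → 𝔄) → ((X × ι → ℝ) →ₗ[ℝ] (X' × ι → ℝ)) :=
  fun n A' => vWEntriesC e π η η' ν G S D₃ D SD G' S' D₃' D' SD' (v1fieldsOfGauge 𝔄 J s' η' A') (v1fieldsOfGauge 𝔄 J s η (gavgM 𝔄 J π A')) (Wc A') (Wf A') n

/-- THE KERNEL FAMILY over g3's paired gauge instance with these ops (spacings `η = g.eta`, `η′ = η·(L^n)⁻¹`). [cite: Balaban1985BackgroundPropagators, (3.42) p.397, (3.60) p.402 (shapes)] -/
def vWGCFamily4 (Wc : (J → X' → 𝔄) → ((X × ι → ℝ) →ₗ[ℝ] (X × ι → ℝ))) (Wf : (J → X' → 𝔄) → ((X' × ι → ℝ) →ₗ[ℝ] (X' × ι → ℝ)))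
    (s : J → X ≃ X) (s' : J → X' ≃ X') (n : ℕ) (hL : g.L ≠ 0) (ν : J ⊕ J)
    (G S D₃ : (X × ι → ℝ) →ₗ[ℝ] (X × ι → ℝ)) (D SD : J ⊕ J → (X × ι → ℝ) →ₗ[ℝ] (X × ι → ℝ)) (G' S' D₃' : (X' × ι → ℝ) →ₗ[ℝ] (X' × ι → ℝ))
    (D' SD' : J ⊕ J → (X' × ι → ℝ) →ₗ[ℝ] (X' × ι → ℝ)) :
    B9.KernelFamily (v1GaugeInstance 𝔄 J ι blk π s s' n hL).gc (v1GaugeInstance 𝔄 J ι blk π s s' n hL).Bf :=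
  show B9.KernelFamily (opGeo g (X × ι) (liftBlk blk ι)) (v1GaugeBg 𝔄 J s' (g.eta * (g.L ^ n)⁻¹) g.M) from
    opFamily (g := g) (B := v1GaugeBg 𝔄 J s' (g.eta * (g.L ^ n)⁻¹) g.M) (liftBlk blk ι) (liftBlk (blk ∘ π) ι)
      (vWGOpsC4 e π Wc Wf s s' g.eta (g.eta * (g.L ^ n)⁻¹) ν G S D₃ D SD G' S' D₃' D' SD')

variable {G S D₃ : (X × ι → ℝ) →ₗ[ℝ] (X × ι → ℝ)} {D SD : J ⊕ J → (X × ι → ℝ) →ₗ[ℝ] (X × ι → ℝ)} {G' S' D₃' : (X' × ι → ℝ) →ₗ[ℝ] (X' × ι → ℝ)}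
  {D' SD' : J ⊕ J → (X' × ι → ℝ) →ₗ[ℝ] (X' × ι → ℝ)}


/-- **THE FOUR ENTRY DEFECTS WITH THE FULL PERTURBATION LIVE AND THE COARSE `V′₁` AT THE MEAN FIELD's TRIPLE, UNDER THE GUARD** — F2's `hasMaj_vWEntries` over one
gauge field `A′` (hypotheses of `vWC_letters_of_gauge` + the `U ≡ 1` layer); ONE application of V0's `hasMaj_entries_of_letters`.
[cite: Balaban1985BackgroundPropagators, Thm 3.1 (3.42) p.397 (quantifier template, entries: shapes); (3.35) p.396, (3.52) p.400, (3.60) p.402, (3.63)–(3.65) pp.402–403 (shapes, mechanism)] -/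
theorem hasMaj_vWEntriesC (htri : Triangle254 g) (hd : ∀ a b : g.Site, 0 ≤ g.dist a b) {σ cr : ℝ} (hσ : 0 ≤ σ) (hcr : 0 ≤ cr) (hrow : RowSum g σ cr)
    {s : J → X ≃ X} {s' : J → X' ≃ X'} {N : ℕ} {δ β m₀ θ c c' a₀ M α₀ η η' Cπ cW : ℝ} (hσδ : σ ≤ δ) (hβ : 0 ≤ β) (hm₀ : 0 ≤ m₀) (hθ : 0 ≤ θ)
    (hcomm : ∀ μ κ x, (s' μ).symm (s' κ x) = s' κ ((s' μ).symm x)) (hCπ : 0 ≤ Cπ)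
    (hconn : ∀ (f : X' → 𝔄) (b : ℝ), (∀ κ x, ‖f (s' κ x) - f x‖ ≤ b) → ∀ x₁ x₂, π x₁ = π x₂ → ‖f x₁ - f x₂‖ ≤ Cπ * b)
    (hblk : ∀ μ x', π ((s' μ ^ N) x') = s μ (π x')) (hη' : 0 < η') (hη'η : η' ≤ η) (hη1 : η ≤ 1) (hηθ : η ≤ θ) (hN : η = N * η')
    (hc : 0 ≤ c) (hc'0 : 0 < c') (hcc' : (2 + Fintype.card J) * c ≤ c') (hθ' : (1 + Fintype.card J) * Cπ * (c * M * α₀) * η' ≤ c' * M * α₀ * θ)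
    (hM : 1 ≤ M) (hα₀ : 0 < α₀) (hMα : M * α₀ ≤ a₀) (ha₀ : 0 ≤ a₀) (ha₀1 : 2 * (2 * c' * a₀) ≤ 1)
    (hq : β * (gVWc35 J (basisConst e) (2 * c') cW * a₀) * cr ≤ 1 / 2) (hcW : 0 ≤ cW) {ν : J ⊕ J}
    (hG : HasMaj (BlockNorm.ofBlocks g (liftBlk blk ι)) (BlockNorm.ofBlocks g (liftBlk blk ι)) G (fun y y' => β * Real.exp (-(δ * g.dist y y'))))
    (hD : ∀ μ, HasMaj (BlockNorm.ofBlocks g (liftBlk blk ι)) (BlockNorm.ofBlocks g (liftBlk blk ι)) (D μ) (fun y y' => β * Real.exp (-(δ * g.dist y y'))))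
    (hG' : HasMaj (BlockNorm.ofBlocks g (liftBlk (blk ∘ π) ι)) (BlockNorm.ofBlocks g (liftBlk (blk ∘ π) ι)) G' (fun y y' => β * Real.exp (-(δ * g.dist y y'))))
    (hD' : ∀ μ, HasMaj (BlockNorm.ofBlocks g (liftBlk (blk ∘ π) ι)) (BlockNorm.ofBlocks g (liftBlk (blk ∘ π) ι)) (D' μ) (fun y y' => β * Real.exp (-(δ * g.dist y y'))))
    (hS : HasMaj (BlockNorm.ofBlocks g (liftBlk blk ι)) (BlockNorm.ofBlocks g (liftBlk blk ι)) S (fun y y' => β * Real.exp (-(δ * g.dist y y'))))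
    (hSD : ∀ μ, HasMaj (BlockNorm.ofBlocks g (liftBlk blk ι)) (BlockNorm.ofBlocks g (liftBlk blk ι)) (SD μ) (fun y y' => β * Real.exp (-(δ * g.dist y y'))))
    (hD₃' : HasMaj (BlockNorm.ofBlocks g (liftBlk (blk ∘ π) ι)) (BlockNorm.ofBlocks g (liftBlk (blk ∘ π) ι)) D₃' (fun y y' => β * Real.exp (-(δ * g.dist y y'))))
    (hDG : HasMaj (BlockNorm.ofBlocks g (liftBlk blk ι)) (BlockNorm.ofBlocks g (liftBlk (blk ∘ π) ι))
      (idef (pull (liftMap π ι)) (pull (liftMap π ι)) G' G) (fun y y' => m₀ * θ * Real.exp (-(δ * g.dist y y'))))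
    (hDD : ∀ μ, HasMaj (BlockNorm.ofBlocks g (liftBlk blk ι)) (BlockNorm.ofBlocks g (liftBlk (blk ∘ π) ι))
      (idef (pull (liftMap π ι)) (pull (liftMap π ι)) (D' μ) (D μ)) (fun y y' => m₀ * θ * Real.exp (-(δ * g.dist y y'))))
    (hDS : HasMaj (BlockNorm.ofBlocks g (liftBlk blk ι)) (BlockNorm.ofBlocks g (liftBlk (blk ∘ π) ι))
      (idef (pull (liftMap π ι)) (pull (liftMap π ι)) S' S) (fun y y' => m₀ * θ * Real.exp (-(δ * g.dist y y'))))
    (hDSD : ∀ μ, HasMaj (BlockNorm.ofBlocks g (liftBlk blk ι)) (BlockNorm.ofBlocks g (liftBlk (blk ∘ π) ι))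
      (idef (pull (liftMap π ι)) (pull (liftMap π ι)) (SD' μ) (SD μ)) (fun y y' => m₀ * θ * Real.exp (-(δ * g.dist y y'))))
    (hDD₃ : HasMaj (BlockNorm.ofBlocks g (liftBlk blk ι)) (BlockNorm.ofBlocks g (liftBlk (blk ∘ π) ι))
      (idef (pull (liftMap π ι)) (pull (liftMap π ι)) D₃' D₃) (fun y y' => m₀ * θ * Real.exp (-(δ * g.dist y y'))))
    {A' : J → X' → 𝔄} (hreg : (v1GaugeBg 𝔄 J s' η' M).Reg335 c α₀ A')
    {W : (X × ι → ℝ) →ₗ[ℝ] (X × ι → ℝ)} {W' : (X' × ι → ℝ) →ₗ[ℝ] (X' × ι → ℝ)}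
    (hW : HasMaj (BlockNorm.ofBlocks g (liftBlk blk ι)) (BlockNorm.ofBlocks g (liftBlk blk ι)) W (diagK fun _ => cW * (2 * c' * M * α₀)))
    (hW' : HasMaj (BlockNorm.ofBlocks g (liftBlk (blk ∘ π) ι)) (BlockNorm.ofBlocks g (liftBlk (blk ∘ π) ι)) W' (diagK fun _ => cW * (2 * c' * M * α₀)))
    (hDW : HasMaj (BlockNorm.ofBlocks g (liftBlk blk ι)) (BlockNorm.ofBlocks g (liftBlk (blk ∘ π) ι))
      (idef (pull (liftMap π ι)) (pull (liftMap π ι)) W' W) (diagK fun _ => cW * (2 * c' * M * α₀) * θ)) :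
    ∀ n : Fin 4, HasMaj (BlockNorm.ofBlocks g (liftBlk blk ι)) (BlockNorm.ofBlocks g (liftBlk (blk ∘ π) ι))
      (vWEntriesC e π η η' ν G S D₃ D SD G' S' D₃' D' SD' (v1fieldsOfGauge 𝔄 J s' η' A') (v1fieldsOfGauge 𝔄 J s η (gavgM 𝔄 J π A')) W W' n)
      (fun y y' => (if n = 3 then bgConst1 β cr m₀ (gVWc35 J (basisConst e) (2 * c') cW) a₀ else bgConst β cr m₀ (gVWc35 J (basisConst e) (2 * c') cW) a₀) * θ *
        Real.exp (-((δ - σ) * g.dist y y'))) := by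
  obtain ⟨hR0, hRa, hV, hV', hDV⟩ :=
    vWC_letters_of_gauge e (g := g) blk π hcomm hCπ hconn hblk hη' hη'η hη1 hηθ hN hc hc'0 hcc' hθ' hM hα₀ hMα ha₀1 hcW hreg hW hW' hDW
  have hK : 0 ≤ gVWc35 J (basisConst e) (2 * c') cW := (le_gVWc35 (J := J) (basisConst_nonneg e) (by positivity : 0 < 2 * c') hcW).2.1.le
  obtain ⟨h01, h2, h3⟩ := hasMaj_entries_of_letters (liftBlk blk ι) (liftMap π ι) htri hd hσ hcr hrow hσδ hβ hm₀ hθ hK ha₀ hq hR0 hRa hG hD hG' hD'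
    hS hSD hD₃' hDG hDD hDS hDSD hDD₃ hV hV' hDV
  intro n
  fin_cases n
  · exact h01 none
  · exact h01 (some ν)
  · exact h2
  · exact h3

/-- **`EtaRateIneq342` WITH THE FULL PERTURBATION LIVE AND THE COARSE `V′₁` AT THE MEAN FIELD's TRIPLE, FOR ANY FAMILY THAT EVALUATES TO THE ENTRIES** (F2's
`etaRateIneq342_vWEntries`, same constants at `gVWc35(2c′)`). [cite: Balaban1985BackgroundPropagators, Thm 3.1 (3.42) p.397 (shape, quantifier template)] -/
theorem etaRateIneq342_vWEntriesC {B : B9.Backgrounds} (T4 : Fin 4 → B.Cfg → ((X × ι → ℝ) →ₗ[ℝ] (X' × ι → ℝ))) (U : B.Cfg)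
    {s : J → X ≃ X} {s' : J → X' ≃ X'} {N : ℕ} {A' : J → X' → 𝔄}
    {W : (X × ι → ℝ) →ₗ[ℝ] (X × ι → ℝ)} {W' : (X' × ι → ℝ) →ₗ[ℝ] (X' × ι → ℝ)} {ν : J ⊕ J} {η' : ℝ}
    (hT4 : ∀ n, T4 n U = vWEntriesC e π g.eta η' ν G S D₃ D SD G' S' D₃' D' SD' (v1fieldsOfGauge 𝔄 J s' η' A')
      (v1fieldsOfGauge 𝔄 J s g.eta (gavgM 𝔄 J π A')) W W' n)
    (htri : Triangle254 g) (hd : ∀ a b : g.Site, 0 ≤ g.dist a b) {σ cr : ℝ} (hσ : 0 ≤ σ) (hcr : 0 ≤ cr) (hrow : RowSum g σ cr)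
    (hη : 0 < g.eta) (hL : 0 < g.L) (hlen : ∀ y, 1 ≤ g.len y) {δ β m₀ θ c c' a₀ M α₀ γ Cπ cW : ℝ}
    (hσδ : σ ≤ δ) (hβ : 0 ≤ β) (hm₀ : 0 ≤ m₀) (hθ : 0 ≤ θ) (hθγ : ∀ y, θ ≤ rateWeight g γ y)
    (hcomm : ∀ μ κ x, (s' μ).symm (s' κ x) = s' κ ((s' μ).symm x)) (hCπ : 0 ≤ Cπ)
    (hconn : ∀ (f : X' → 𝔄) (b : ℝ), (∀ κ x, ‖f (s' κ x) - f x‖ ≤ b) → ∀ x₁ x₂, π x₁ = π x₂ → ‖f x₁ - f x₂‖ ≤ Cπ * b)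
    (hblk : ∀ μ x', π ((s' μ ^ N) x') = s μ (π x')) (hη' : 0 < η') (hη'η : η' ≤ g.eta) (hη1 : g.eta ≤ 1) (hηθ : g.eta ≤ θ) (hN : g.eta = N * η')
    (hc : 0 ≤ c) (hc'0 : 0 < c') (hcc' : (2 + Fintype.card J) * c ≤ c') (hθ' : (1 + Fintype.card J) * Cπ * (c * M * α₀) * η' ≤ c' * M * α₀ * θ)
    (hM : 1 ≤ M) (hα₀ : 0 < α₀) (hMα : M * α₀ ≤ a₀) (ha₀ : 0 ≤ a₀) (ha₀1 : 2 * (2 * c' * a₀) ≤ 1)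
    (hq : β * (gVWc35 J (basisConst e) (2 * c') cW * a₀) * cr ≤ 1 / 2) (hcW : 0 ≤ cW)
    (hG : HasMaj (BlockNorm.ofBlocks g (liftBlk blk ι)) (BlockNorm.ofBlocks g (liftBlk blk ι)) G (fun y y' => β * Real.exp (-(δ * g.dist y y'))))
    (hD : ∀ μ, HasMaj (BlockNorm.ofBlocks g (liftBlk blk ι)) (BlockNorm.ofBlocks g (liftBlk blk ι)) (D μ) (fun y y' => β * Real.exp (-(δ * g.dist y y'))))
    (hG' : HasMaj (BlockNorm.ofBlocks g (liftBlk (blk ∘ π) ι)) (BlockNorm.ofBlocks g (liftBlk (blk ∘ π) ι)) G' (fun y y' => β * Real.exp (-(δ * g.dist y y'))))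
    (hD' : ∀ μ, HasMaj (BlockNorm.ofBlocks g (liftBlk (blk ∘ π) ι)) (BlockNorm.ofBlocks g (liftBlk (blk ∘ π) ι)) (D' μ) (fun y y' => β * Real.exp (-(δ * g.dist y y'))))
    (hS : HasMaj (BlockNorm.ofBlocks g (liftBlk blk ι)) (BlockNorm.ofBlocks g (liftBlk blk ι)) S (fun y y' => β * Real.exp (-(δ * g.dist y y'))))
    (hSD : ∀ μ, HasMaj (BlockNorm.ofBlocks g (liftBlk blk ι)) (BlockNorm.ofBlocks g (liftBlk blk ι)) (SD μ) (fun y y' => β * Real.exp (-(δ * g.dist y y'))))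
    (hD₃' : HasMaj (BlockNorm.ofBlocks g (liftBlk (blk ∘ π) ι)) (BlockNorm.ofBlocks g (liftBlk (blk ∘ π) ι)) D₃' (fun y y' => β * Real.exp (-(δ * g.dist y y'))))
    (hDG : HasMaj (BlockNorm.ofBlocks g (liftBlk blk ι)) (BlockNorm.ofBlocks g (liftBlk (blk ∘ π) ι))
      (idef (pull (liftMap π ι)) (pull (liftMap π ι)) G' G) (fun y y' => m₀ * θ * Real.exp (-(δ * g.dist y y'))))
    (hDD : ∀ μ, HasMaj (BlockNorm.ofBlocks g (liftBlk blk ι)) (BlockNorm.ofBlocks g (liftBlk (blk ∘ π) ι))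
      (idef (pull (liftMap π ι)) (pull (liftMap π ι)) (D' μ) (D μ)) (fun y y' => m₀ * θ * Real.exp (-(δ * g.dist y y'))))
    (hDS : HasMaj (BlockNorm.ofBlocks g (liftBlk blk ι)) (BlockNorm.ofBlocks g (liftBlk (blk ∘ π) ι))
      (idef (pull (liftMap π ι)) (pull (liftMap π ι)) S' S) (fun y y' => m₀ * θ * Real.exp (-(δ * g.dist y y'))))
    (hDSD : ∀ μ, HasMaj (BlockNorm.ofBlocks g (liftBlk blk ι)) (BlockNorm.ofBlocks g (liftBlk (blk ∘ π) ι))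
      (idef (pull (liftMap π ι)) (pull (liftMap π ι)) (SD' μ) (SD μ)) (fun y y' => m₀ * θ * Real.exp (-(δ * g.dist y y'))))
    (hDD₃ : HasMaj (BlockNorm.ofBlocks g (liftBlk blk ι)) (BlockNorm.ofBlocks g (liftBlk (blk ∘ π) ι))
      (idef (pull (liftMap π ι)) (pull (liftMap π ι)) D₃' D₃) (fun y y' => m₀ * θ * Real.exp (-(δ * g.dist y y'))))
    (hreg : (v1GaugeBg 𝔄 J s' η' M).Reg335 c α₀ A')
    (hW : HasMaj (BlockNorm.ofBlocks g (liftBlk blk ι)) (BlockNorm.ofBlocks g (liftBlk blk ι)) W (diagK fun _ => cW * (2 * c' * M * α₀)))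
    (hW' : HasMaj (BlockNorm.ofBlocks g (liftBlk (blk ∘ π) ι)) (BlockNorm.ofBlocks g (liftBlk (blk ∘ π) ι)) W' (diagK fun _ => cW * (2 * c' * M * α₀)))
    (hDW : HasMaj (BlockNorm.ofBlocks g (liftBlk blk ι)) (BlockNorm.ofBlocks g (liftBlk (blk ∘ π) ι))
      (idef (pull (liftMap π ι)) (pull (liftMap π ι)) W' W) (diagK fun _ => cW * (2 * c' * M * α₀) * θ)) :
    EtaRateIneq342 (opFamily (g := g) (B := B) (liftBlk blk ι) (liftBlk (blk ∘ π) ι) T4)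
      (bgConst β cr m₀ (gVWc35 J (basisConst e) (2 * c') cW) a₀ + bgConst1 β cr m₀ (gVWc35 J (basisConst e) (2 * c') cW) a₀) (δ - σ) γ U := by
  have key := hasMaj_vWEntriesC e blk π htri hd hσ hcr hrow hσδ hβ hm₀ hθ hcomm hCπ hconn hblk hη' hη'η hη1 hηθ hN hc hc'0 hcc' hθ' hM hα₀ hMα ha₀
    ha₀1 hq hcW (ν := ν) hG hD hG' hD' hS hSD hD₃' hDG hDD hDS hDSD hDD₃ hreg hW hW' hDW
  have hgc : 0 ≤ gVWc35 J (basisConst e) (2 * c') cW := (le_gVWc35 (J := J) (basisConst_nonneg e) (by positivity : 0 < 2 * c') hcW).2.1.le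
  have hC0 : 0 ≤ bgConst β cr m₀ (gVWc35 J (basisConst e) (2 * c') cW) a₀ := bgConst_nonneg hβ hcr hm₀ hgc ha₀
  have hC1 : 0 ≤ bgConst1 β cr m₀ (gVWc35 J (basisConst e) (2 * c') cW) a₀ := bgConst1_nonneg hβ hcr hm₀ hgc ha₀
  refine etaRateIneq342_of_hasMaj (g := g) (B := B) (liftBlk blk ι) (liftBlk (blk ∘ π) ι) hη.le hL.le (add_nonneg hC0 hC1) T4 U fun n => ?_
  rw [hT4 n]
  refine (key n).mono fun y y' => ?_
  by_cases hn : n = 3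
  · simp only [hn, if_true]
    exact entryMajorant_le_etaRateShape (X := X × ι) (liftBlk blk ι) hη hL hlen (δ₀ := δ - σ) hθ hθγ hC1 (le_add_of_nonneg_left hC0) 3 y y'
  · simp only [hn, if_false]
    exact entryMajorant_le_etaRateShape (X := X × ι) (liftBlk blk ι) hη hL hlen (δ₀ := δ - σ) hθ hθγ hC0 (le_add_of_nonneg_right hC1) n y y'


end Entries

end Summit.QuantumFields.YangMills.BalabanUVNodes.N15.BackgroundLayer

end
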